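import Summits.AtomisticToContinuum.Crystallization.Theorems.ChessboardParticlePlanesPeriodicWindowsOfBarlowWindows
import Summits.AtomisticToContinuum.Crystallization.Theorems.ChessboardParticlePlanesPeriodicWindowsGoodLimit
import Summits.AtomisticToContinuum.Crystallization.Theorems.ChessboardParticlePlanesPeriodicWindowsHexClosure
import Summits.AtomisticToContinuum.Crystallization.Theorems.ChessboardParticlePlanesPeriodicWindowsLevelLattice
import Summits.AtomisticToContinuum.Crystallization.Theorems.ChessboardParticlePlanesPeriodicWindowsLevelRegistry
import Summits.AtomisticToContinuum.Crystallization.Theorems.ChessboardParticlePlanesPeriodicWindowsBarlowOfLevels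

/-!
# Crux `PeriodicWindows` (stmt-AtomisticToContinuum-3240), line `Sketch` — the bridges `GOOD windows ⇒ PeriodicWindows / LayeredWindows`

Sorry-free extract of the lead skeleton rev 10 (`Cruxes/PeriodicWindows/Lines/Sketch.lean`, lead
prover-line-stmt-AtomisticToContinuum-3240-c4-0): every stub of rev 10 except its INPUT S0' (= the consequent of board item
stmt-14294 `LaminarSixThreeThree.LaminarSaturation`, i.e. a.e. GOOD windows) is LANDED — E0a `stub_goodLimit` (compactness),
E0b1a `stub_hexClosure`, E0b1b `stub_levelLattice`, E0b2 `stub_levelRegistry`, E0b3 `stub_barlowOfLevels` (exact two-length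
6 + 3 + 3 rigidity) — so the composition is a genuine theorem CONDITIONAL on 14293 ∧ 14294 only:

* `goodWindow_frequently` — counting glue (a.e. GOOD windows ⇒ one GOOD window per scale, frequently in `N`);
* `barlowWindows_of_goodWindows` — for ONE sequence of configurations: GOOD windows at every scale, frequently in `N`, give
  Barlow windows at every scale, frequently in `N` (exact layered limit by compactness, identified as a rotated Barlow stacking
  by the exact rigidity, read back on the windows) — the hypothesis `hW` of the landed `periodicWindows_of_barlowWindows`;
* `PeriodicWindows_of_goodWindowsAE` — a.e. GOOD windows ⇒ the crux `PeriodicWindows`;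
* `LayeredWindows_of_goodWindowsAE` — a.e. GOOD windows ⇒ `HullMinimality.LayeredWindows` (item 11778);
* `PeriodicWindows_of_laminarity_saturation : LjLaminarity → LaminarSaturation → PeriodicWindows` — 14293 ∧ 14294 ⇒ 3240:
  neither `LaminarRigidity` (14295, the quantitative `C(R)·ε` rigidity) nor `StackingFaultSparsity` (14296) is needed on the
  board path to conjunct (ii); the line uses only the `ε = 0` shadow of 14295, proved here as E0b1–3.

All `[folklore]` bookkeeping over the landed stubs; `--supports stmt-AtomisticToContinuum-3240`.
-/

noncomputable section

namespace Summit.AtomisticToContinuum.Crystallization.Theorems.PeriodicWindowsSketch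

open Literature.MathematicalPhysics.StatisticalMechanics Filter Metric
open Summit.AtomisticToContinuum.Crystallization.Theses.ChessboardParticlePlanes (PeriodicWindows)
open Summit.AtomisticToContinuum.Crystallization.Theses.LaminarSixThreeThree (LjLaminarity LaminarSaturation)

/-! ## G1' — one GOOD window per scale, frequently in `N` (glue, proved) -/

/-- G1' (glue, proved): a.e. GOOD windows (S0') give, for every `R ≥ 2`, `ε > 0` and every ground-state sequence,
frequently (indeed eventually) in `N` a particle with a GOOD `(R, ε)`-window
(`eventually_exists_of_card_div_tendsto_zero` with both predicates equal). -/
theorem goodWindow_frequently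
    (hS0 : ∀ R ε : ℝ, 2 ≤ R → 0 < ε → ∀ x : (N : ℕ) → (Fin N → EuclideanSpace ℝ (Fin 3)),
      (∀ N, IsGroundState lennardJones (x N)) →
      Filter.Tendsto (fun N : ℕ => (Nat.card {i : Fin N // ¬ (∃ a b : ℝ, 19 / 20 ≤ a ∧ a ≤ 1 ∧ 19 / 20 ≤ b ∧
        b ≤ 1 ∧ ∃ n : EuclideanSpace ℝ (Fin 3), ‖n‖ = 1 ∧ ∃ c : ℤ → ℝ, (∀ k : ℤ, c k + 19 / 25 ≤ c (k + 1)) ∧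
        ∃ l : Fin N → ℤ, (∀ j : Fin N, dist (x N j) (x N i) ≤ R → |inner ℝ (x N j - x N i) n - c (l j)| ≤ ε) ∧
        (∀ j k : Fin N, dist (x N j) (x N i) ≤ R → dist (x N k) (x N i) ≤ R → j ≠ k →
          19 / 20 ≤ dist (x N j) (x N k)) ∧
        ∀ j : Fin N, dist (x N j) (x N i) ≤ R / 2 →
          Nat.card {k : Fin N // k ≠ j ∧ l k = l j ∧ dist (x N j) (x N k) ≤ 1} = 6 ∧
          Nat.card {k : Fin N // l k = l j + 1 ∧ dist (x N j) (x N k) ≤ 1} = 3 ∧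
          Nat.card {k : Fin N // l k = l j - 1 ∧ dist (x N j) (x N k) ≤ 1} = 3 ∧
          ∀ k : Fin N, k ≠ j → dist (x N j) (x N k) ≤ 1 →
            (l k = l j → |dist (x N j) (x N k) - a| ≤ ε) ∧ (l k ≠ l j → |dist (x N j) (x N k) - b| ≤ ε))} : ℝ) / N)
        Filter.atTop (nhds 0))
    (x : (N : ℕ) → (Fin N → EuclideanSpace ℝ (Fin 3))) (hx : ∀ N, IsGroundState lennardJones (x N)) :
    ∀ R ε : ℝ, 2 ≤ R → 0 < ε → ∃ᶠ N in Filter.atTop, ∃ (i : Fin N) (a b : ℝ), 19 / 20 ≤ a ∧ a ≤ 1 ∧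
      19 / 20 ≤ b ∧ b ≤ 1 ∧ ∃ n : EuclideanSpace ℝ (Fin 3), ‖n‖ = 1 ∧ ∃ c : ℤ → ℝ,
      (∀ k : ℤ, c k + 19 / 25 ≤ c (k + 1)) ∧ ∃ l : Fin N → ℤ,
      (∀ j : Fin N, dist (x N j) (x N i) ≤ R → |inner ℝ (x N j - x N i) n - c (l j)| ≤ ε) ∧
      (∀ j k : Fin N, dist (x N j) (x N i) ≤ R → dist (x N k) (x N i) ≤ R → j ≠ k → 19 / 20 ≤ dist (x N j) (x N k)) ∧
      ∀ j : Fin N, dist (x N j) (x N i) ≤ R / 2 →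
        Nat.card {k : Fin N // k ≠ j ∧ l k = l j ∧ dist (x N j) (x N k) ≤ 1} = 6 ∧
        Nat.card {k : Fin N // l k = l j + 1 ∧ dist (x N j) (x N k) ≤ 1} = 3 ∧
        Nat.card {k : Fin N // l k = l j - 1 ∧ dist (x N j) (x N k) ≤ 1} = 3 ∧
        ∀ k : Fin N, k ≠ j → dist (x N j) (x N k) ≤ 1 →
          (l k = l j → |dist (x N j) (x N k) - a| ≤ ε) ∧ (l k ≠ l j → |dist (x N j) (x N k) - b| ≤ ε) := by
  intro R ε hR hε
  -- abbreviate the GOOD predicate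
  set Q : (N : ℕ) → Fin N → Prop := fun N i => ∃ a b : ℝ, 19 / 20 ≤ a ∧ a ≤ 1 ∧
      19 / 20 ≤ b ∧ b ≤ 1 ∧ ∃ n : EuclideanSpace ℝ (Fin 3), ‖n‖ = 1 ∧ ∃ c : ℤ → ℝ,
      (∀ k : ℤ, c k + 19 / 25 ≤ c (k + 1)) ∧ ∃ l : Fin N → ℤ,
      (∀ j : Fin N, dist (x N j) (x N i) ≤ R → |inner ℝ (x N j - x N i) n - c (l j)| ≤ ε) ∧
      (∀ j k : Fin N, dist (x N j) (x N i) ≤ R → dist (x N k) (x N i) ≤ R → j ≠ k → 19 / 20 ≤ dist (x N j) (x N k)) ∧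
      ∀ j : Fin N, dist (x N j) (x N i) ≤ R / 2 →
        Nat.card {k : Fin N // k ≠ j ∧ l k = l j ∧ dist (x N j) (x N k) ≤ 1} = 6 ∧
        Nat.card {k : Fin N // l k = l j + 1 ∧ dist (x N j) (x N k) ≤ 1} = 3 ∧
        Nat.card {k : Fin N // l k = l j - 1 ∧ dist (x N j) (x N k) ≤ 1} = 3 ∧
        ∀ k : Fin N, k ≠ j → dist (x N j) (x N k) ≤ 1 →
          (l k = l j → |dist (x N j) (x N k) - a| ≤ ε) ∧ (l k ≠ l j → |dist (x N j) (x N k) - b| ≤ ε) with hQ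
  have hP : Filter.Tendsto (fun N : ℕ => (Nat.card {i : Fin N // ¬ Q N i} : ℝ) / N) Filter.atTop (nhds 0) :=
    hS0 R ε hR hε x hx
  have h0 : ∀ N : ℕ, (Nat.card {i : Fin N // Q N i ∧ ¬ Q N i} : ℝ) / N = 0 := by
    intro N
    have : IsEmpty {i : Fin N // Q N i ∧ ¬ Q N i} := ⟨fun ⟨_, h1, h2⟩ => h2 h1⟩
    rw [Nat.card_of_isEmpty]
    simp
  have hev := eventually_exists_of_card_div_tendsto_zero (P := Q) (Q := Q) hP
    (by simp_rw [h0]; exact tendsto_const_nhds)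
  exact hev.frequently.mono fun N ⟨i, hi⟩ => ⟨i, hi⟩

/-! ## E0a, E0b1a, E0b1b, E0b2, E0b3 — ALL LANDED (wave 1 of lead c4, 2026-08-17T01:00–01:30Z), imported above:
`stub_goodLimit` (E0a, p136031; helpers `…GoodLimitA/B/C.lean` p135552 p135560 p135717),
`stub_hexClosure` (E0b1a, p135047), `stub_levelLattice` (E0b1b, p134939),
`stub_levelRegistry` (E0b2, p135738; helper `…LevelRegistryA.lean` p135505), `stub_barlowOfLevels` (E0b3, p134978). -/

/-! ## GLUE: GOOD windows at every scale ⇒ Barlow windows at every scale (per sequence) -/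

/-- Numerics (proved): for `a, b ∈ [19/20, 1]` the gap `h = √(b² − a²/3)` lies in `(1/2, 2)` (indeed in
`[0.754, 0.837]`). -/
theorem sqrt_gap_bounds {a b : ℝ} (ha1 : 19 / 20 ≤ a) (ha2 : a ≤ 1) (hb1 : 19 / 20 ≤ b) (hb2 : b ≤ 1) :
    1 / 2 < Real.sqrt (b ^ 2 - a ^ 2 / 3) ∧ Real.sqrt (b ^ 2 - a ^ 2 / 3) < 2 := by
  constructor
  · rw [show (1 / 2 : ℝ) = Real.sqrt (1 / 4) by
      rw [show (1 / 4 : ℝ) = (1 / 2) ^ 2 by norm_num, Real.sqrt_sq (by norm_num)]]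
    exact Real.sqrt_lt_sqrt (by norm_num) (by nlinarith)
  · rw [show (2 : ℝ) = Real.sqrt 4 by
      rw [show (4 : ℝ) = 2 ^ 2 by norm_num, Real.sqrt_sq (by norm_num)]]
    exact Real.sqrt_lt_sqrt (by nlinarith) (by nlinarith)

/-- **GLUE (proved; E0a, E0b1–3 landed): Barlow windows from GOOD windows, for ONE sequence of configurations.**
If at every scale `R ≥ 2`, `ε > 0`, frequently in `N`, some particle of `x N` has a GOOD `(R, ε)`-window, then for
every `R > 0`, `ε ∈ (0, 1/4)`, frequently in `N`, some particle has an `(R, ε)`-window matched after a rigid motion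
to SOME Barlow stacking with `a, h ∈ (1/2, 2)` — exactly the hypothesis `hW` of the landed
`periodicWindows_of_barlowWindows`. (Windows beyond any `N₀` at scales `(k + 2, 1/(k + 1))`; E0a limit; E0b1–3
identify it as `A '' barlowStacking a h s` through `0`; the two-way matching at a large `k ≥ R` is read back on the
`k`-th window with the isometry `B⁻¹ ∘ A` and the stacking point `z = 0`.) -/
theorem barlowWindows_of_goodWindows (x : (N : ℕ) → (Fin N → EuclideanSpace ℝ (Fin 3)))
    (hG : ∀ R ε : ℝ, 2 ≤ R → 0 < ε → ∃ᶠ N in Filter.atTop, ∃ (i : Fin N) (a b : ℝ), 19 / 20 ≤ a ∧ a ≤ 1 ∧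
      19 / 20 ≤ b ∧ b ≤ 1 ∧ ∃ n : EuclideanSpace ℝ (Fin 3), ‖n‖ = 1 ∧ ∃ c : ℤ → ℝ,
      (∀ k : ℤ, c k + 19 / 25 ≤ c (k + 1)) ∧ ∃ l : Fin N → ℤ,
      (∀ j : Fin N, dist (x N j) (x N i) ≤ R → |inner ℝ (x N j - x N i) n - c (l j)| ≤ ε) ∧
      (∀ j k : Fin N, dist (x N j) (x N i) ≤ R → dist (x N k) (x N i) ≤ R → j ≠ k → 19 / 20 ≤ dist (x N j) (x N k)) ∧
      ∀ j : Fin N, dist (x N j) (x N i) ≤ R / 2 →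
        Nat.card {k : Fin N // k ≠ j ∧ l k = l j ∧ dist (x N j) (x N k) ≤ 1} = 6 ∧
        Nat.card {k : Fin N // l k = l j + 1 ∧ dist (x N j) (x N k) ≤ 1} = 3 ∧
        Nat.card {k : Fin N // l k = l j - 1 ∧ dist (x N j) (x N k) ≤ 1} = 3 ∧
        ∀ k : Fin N, k ≠ j → dist (x N j) (x N k) ≤ 1 →
          (l k = l j → |dist (x N j) (x N k) - a| ≤ ε) ∧ (l k ≠ l j → |dist (x N j) (x N k) - b| ≤ ε)) :
    ∀ R ε : ℝ, 0 < R → 0 < ε → ε < 1 / 4 → ∃ᶠ N in Filter.atTop, ∃ (i : Fin N) (a h : ℝ),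
      1 / 2 < a ∧ a < 2 ∧ 1 / 2 < h ∧ h < 2 ∧ ∃ s : ℤ → ℤ, IsHaggSeq s ∧ ∃ z ∈ barlowStacking a h s,
        ∃ A : EuclideanSpace ℝ (Fin 3) →ₗᵢ[ℝ] EuclideanSpace ℝ (Fin 3),
          (∀ p ∈ barlowStacking a h s, dist p z ≤ R → ∃ j : Fin N, dist (x N j) (x N i + A (p - z)) ≤ ε) ∧
          (∀ j : Fin N, dist (x N j) (x N i) ≤ R →
            ∃ p ∈ barlowStacking a h s, dist (x N j) (x N i + A (p - z)) ≤ ε) := by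
  intro R ε hR hε _hε4
  rw [Filter.frequently_atTop]
  intro N₀
  -- Step 1: GOOD windows at scale `(k + 2, 1/(k + 1))` beyond `N₀`
  have hch : ∀ k : ℕ, ∃ N ≥ N₀, ∃ (i : Fin N) (a b : ℝ), 19 / 20 ≤ a ∧ a ≤ 1 ∧
      19 / 20 ≤ b ∧ b ≤ 1 ∧ ∃ n : EuclideanSpace ℝ (Fin 3), ‖n‖ = 1 ∧ ∃ c : ℤ → ℝ,
      (∀ m : ℤ, c m + 19 / 25 ≤ c (m + 1)) ∧ ∃ l : Fin N → ℤ,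
      (∀ j : Fin N, dist (x N j) (x N i) ≤ (k : ℝ) + 2 → |inner ℝ (x N j - x N i) n - c (l j)| ≤ 1 / ((k : ℝ) + 1)) ∧
      (∀ j j' : Fin N, dist (x N j) (x N i) ≤ (k : ℝ) + 2 → dist (x N j') (x N i) ≤ (k : ℝ) + 2 → j ≠ j' →
        19 / 20 ≤ dist (x N j) (x N j')) ∧
      ∀ j : Fin N, dist (x N j) (x N i) ≤ ((k : ℝ) + 2) / 2 →
        Nat.card {j' : Fin N // j' ≠ j ∧ l j' = l j ∧ dist (x N j) (x N j') ≤ 1} = 6 ∧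
        Nat.card {j' : Fin N // l j' = l j + 1 ∧ dist (x N j) (x N j') ≤ 1} = 3 ∧
        Nat.card {j' : Fin N // l j' = l j - 1 ∧ dist (x N j) (x N j') ≤ 1} = 3 ∧
        ∀ j' : Fin N, j' ≠ j → dist (x N j) (x N j') ≤ 1 →
          (l j' = l j → |dist (x N j) (x N j') - a| ≤ 1 / ((k : ℝ) + 1)) ∧
          (l j' ≠ l j → |dist (x N j) (x N j') - b| ≤ 1 / ((k : ℝ) + 1)) := fun k =>
    Filter.frequently_atTop.1 (hG ((k : ℝ) + 2) (1 / ((k : ℝ) + 1)) (by linarith [(Nat.cast_nonneg k : (0 : ℝ) ≤ k)])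
      (by positivity)) N₀
  choose Nk hNk ik hgood using hch
  -- Step 2: the exact layered limit (E0a) and its rigidity (E0b1–3)
  obtain ⟨φ, B, X, a, b, hφ, hlim, h0, ha1, ha2, hb1, hb2, hsep, hgap, hsharp, hsix, hup, hdn⟩ :=
    stub_goodLimit Nk (fun k => x (Nk k)) ik hgood
  have hlat := stub_levelLattice X a ha1 ha2 hsep hsix (stub_hexClosure X a ha1 ha2 hsharp hsix)
  obtain ⟨u, v, hu2, hv2, hu, hv, huv, hlev0⟩ := hlat 0 h0
  set h : ℝ := Real.sqrt (b ^ 2 - a ^ 2 / 3) with hh_def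
  obtain ⟨hh1, hh2⟩ := sqrt_gap_bounds ha1 ha2 hb1 hb2
  have ha : 0 < a := by linarith
  have hh : 0 < h := by linarith
  have hlev0' : {q ∈ X | q 2 = 0} = {q | ∃ i j : ℤ, q = (i : ℝ) • u + (j : ℝ) • v} := by
    rw [show (0 : ℝ) = (0 : EuclideanSpace ℝ (Fin 3)) 2 from rfl, hlev0]
    ext q
    simp only [Set.mem_setOf_eq, zero_add]
  have hstep : ∀ p ∈ X, {q ∈ X | q 2 = p 2} = {q | ∃ i j : ℤ, q = p + (i : ℝ) • u + (j : ℝ) • v} →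
      ∃ σ τ : ℝ, (σ = 1 ∨ σ = -1) ∧ (τ = 1 ∨ τ = -1) ∧
        {q ∈ X | q 2 = p 2 + h} =
          {q | ∃ i j : ℤ, q = p + h • EuclideanSpace.single (2 : Fin 3) (1 : ℝ) +
            σ • ((1 / 3 : ℝ) • (u + v)) + (i : ℝ) • u + (j : ℝ) • v} ∧
        {q ∈ X | q 2 = p 2 - h} =
          {q | ∃ i j : ℤ, q = p - h • EuclideanSpace.single (2 : Fin 3) (1 : ℝ) +
            τ • ((1 / 3 : ℝ) • (u + v)) + (i : ℝ) • u + (j : ℝ) • v} ∧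
        ∀ q ∈ X, |q 2 - p 2| < h → q 2 = p 2 := fun p hp hlev =>
    stub_levelRegistry X a b ha1 ha2 hb1 hb2 hsep hgap hlat hup hdn p hp u v hu2 hv2 hu hv huv hlev
  obtain ⟨s, A, hs, hXeq⟩ := stub_barlowOfLevels X a h ha hh h0 u v hu2 hv2 hu hv huv hlev0' hstep
  -- Step 3: read the matching back on a window at a large scale `k ≥ R`
  obtain ⟨k, hk, hkR⟩ := ((hlim R ε hε).and (Filter.eventually_ge_atTop ⌈R⌉₊)).exists
  have hkR' : R ≤ (φ k : ℝ) + 2 := by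
    have h1 : R ≤ (⌈R⌉₊ : ℝ) := Nat.le_ceil R
    have h2 : (⌈R⌉₊ : ℝ) ≤ (k : ℝ) := by exact_mod_cast hkR
    have h3 : (k : ℝ) ≤ (φ k : ℝ) := by exact_mod_cast hφ.id_le k
    linarith
  set N := Nk (φ k) with hN
  set i := ik (φ k) with hi
  have hz : (0 : EuclideanSpace ℝ (Fin 3)) ∈ barlowStacking a h s :=
    ⟨0, 0, 0, by simp [barlowPos]⟩
  refine ⟨N, hNk (φ k), i, a, h, by linarith, by linarith, hh1, hh2, s, hs, 0, hz,
    B.symm.toLinearIsometry.comp A, ?_, ?_⟩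
  · intro p hp hpR
    have hApX : A p ∈ X := by rw [hXeq]; exact ⟨p, hp, rfl⟩
    have hAp0 : dist (A p) 0 ≤ R := by
      rw [dist_zero_right, A.norm_map, ← dist_zero_right]; exact hpR
    obtain ⟨q, ⟨j, hj, rfl⟩, hq⟩ := hk.1 (A p) hApX hAp0
    refine ⟨j, ?_⟩
    have hcomp : (B.symm.toLinearIsometry.comp A) (p - 0) = B.symm (A p) := by
      rw [sub_zero]; rfl
    rw [hcomp]
    calc dist (x N j) (x N i + B.symm (A p))
        = dist (B (x N j - x N i)) (A p) := by
          rw [← B.dist_map (x N j) (x N i + B.symm (A p)), map_add, LinearIsometryEquiv.apply_symm_apply,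
            map_sub, dist_eq_norm, dist_eq_norm]
          congr 1; abel
      _ ≤ ε := hq
  · intro j hj
    have hmem : B (x N j - x N i) ∈ {p | ∃ j : Fin (Nk (φ k)), dist (x (Nk (φ k)) j) (x (Nk (φ k)) (ik (φ k))) ≤
        (φ k : ℝ) + 2 ∧ p = B (x (Nk (φ k)) j - x (Nk (φ k)) (ik (φ k)))} := ⟨j, hj.trans hkR', rfl⟩
    have hnorm : dist (B (x N j - x N i)) 0 ≤ R := by
      rw [dist_zero_right, B.norm_map, ← dist_eq_norm]; exact hj
    obtain ⟨q, hqX, hq⟩ := hk.2 _ hmem hnorm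
    rw [hXeq] at hqX
    obtain ⟨p, hp, rfl⟩ := hqX
    refine ⟨p, hp, ?_⟩
    have hcomp : (B.symm.toLinearIsometry.comp A) (p - 0) = B.symm (A p) := by
      rw [sub_zero]; rfl
    rw [hcomp]
    calc dist (x N j) (x N i + B.symm (A p))
        = dist (B (x N j - x N i)) (A p) := by
          rw [← B.dist_map (x N j) (x N i + B.symm (A p)), map_add, LinearIsometryEquiv.apply_symm_apply,
            map_sub, dist_eq_norm, dist_eq_norm]
          congr 1; abel
      _ ≤ ε := hq

/-! ## BRIDGES and the composition -/

/-- **BRIDGE (proved; E0a, E0b1–3 landed): a.e. GOOD windows ⇒ the crux `PeriodicWindows`** (G1' + the glue above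
+ the LANDED `periodicWindows_of_barlowWindows`). -/
theorem PeriodicWindows_of_goodWindowsAE
    (hS0 : ∀ R ε : ℝ, 2 ≤ R → 0 < ε → ∀ x : (N : ℕ) → (Fin N → EuclideanSpace ℝ (Fin 3)),
      (∀ N, IsGroundState lennardJones (x N)) →
      Filter.Tendsto (fun N : ℕ => (Nat.card {i : Fin N // ¬ (∃ a b : ℝ, 19 / 20 ≤ a ∧ a ≤ 1 ∧ 19 / 20 ≤ b ∧
        b ≤ 1 ∧ ∃ n : EuclideanSpace ℝ (Fin 3), ‖n‖ = 1 ∧ ∃ c : ℤ → ℝ, (∀ k : ℤ, c k + 19 / 25 ≤ c (k + 1)) ∧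
        ∃ l : Fin N → ℤ, (∀ j : Fin N, dist (x N j) (x N i) ≤ R → |inner ℝ (x N j - x N i) n - c (l j)| ≤ ε) ∧
        (∀ j k : Fin N, dist (x N j) (x N i) ≤ R → dist (x N k) (x N i) ≤ R → j ≠ k →
          19 / 20 ≤ dist (x N j) (x N k)) ∧
        ∀ j : Fin N, dist (x N j) (x N i) ≤ R / 2 →
          Nat.card {k : Fin N // k ≠ j ∧ l k = l j ∧ dist (x N j) (x N k) ≤ 1} = 6 ∧
          Nat.card {k : Fin N // l k = l j + 1 ∧ dist (x N j) (x N k) ≤ 1} = 3 ∧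
          Nat.card {k : Fin N // l k = l j - 1 ∧ dist (x N j) (x N k) ≤ 1} = 3 ∧
          ∀ k : Fin N, k ≠ j → dist (x N j) (x N k) ≤ 1 →
            (l k = l j → |dist (x N j) (x N k) - a| ≤ ε) ∧ (l k ≠ l j → |dist (x N j) (x N k) - b| ≤ ε))} : ℝ) / N)
        Filter.atTop (nhds 0)) :
    PeriodicWindows := fun x hx =>
  periodicWindows_of_barlowWindows x hx (barlowWindows_of_goodWindows x (goodWindow_frequently hS0 x hx))

/-- **BRIDGE (proved; E0a, E0b1–3 landed): a.e. GOOD windows ⇒ `HullMinimality.LayeredWindows` (item 11778).** -/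
theorem LayeredWindows_of_goodWindowsAE
    (hS0 : ∀ R ε : ℝ, 2 ≤ R → 0 < ε → ∀ x : (N : ℕ) → (Fin N → EuclideanSpace ℝ (Fin 3)),
      (∀ N, IsGroundState lennardJones (x N)) →
      Filter.Tendsto (fun N : ℕ => (Nat.card {i : Fin N // ¬ (∃ a b : ℝ, 19 / 20 ≤ a ∧ a ≤ 1 ∧ 19 / 20 ≤ b ∧
        b ≤ 1 ∧ ∃ n : EuclideanSpace ℝ (Fin 3), ‖n‖ = 1 ∧ ∃ c : ℤ → ℝ, (∀ k : ℤ, c k + 19 / 25 ≤ c (k + 1)) ∧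
        ∃ l : Fin N → ℤ, (∀ j : Fin N, dist (x N j) (x N i) ≤ R → |inner ℝ (x N j - x N i) n - c (l j)| ≤ ε) ∧
        (∀ j k : Fin N, dist (x N j) (x N i) ≤ R → dist (x N k) (x N i) ≤ R → j ≠ k →
          19 / 20 ≤ dist (x N j) (x N k)) ∧
        ∀ j : Fin N, dist (x N j) (x N i) ≤ R / 2 →
          Nat.card {k : Fin N // k ≠ j ∧ l k = l j ∧ dist (x N j) (x N k) ≤ 1} = 6 ∧
          Nat.card {k : Fin N // l k = l j + 1 ∧ dist (x N j) (x N k) ≤ 1} = 3 ∧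
          Nat.card {k : Fin N // l k = l j - 1 ∧ dist (x N j) (x N k) ≤ 1} = 3 ∧
          ∀ k : Fin N, k ≠ j → dist (x N j) (x N k) ≤ 1 →
            (l k = l j → |dist (x N j) (x N k) - a| ≤ ε) ∧ (l k ≠ l j → |dist (x N j) (x N k) - b| ≤ ε))} : ℝ) / N)
        Filter.atTop (nhds 0)) :
    Summit.AtomisticToContinuum.Crystallization.Theses.HullMinimality.LayeredWindows := fun x hx =>
  layeredWindows_of_barlowWindows x hx (barlowWindows_of_goodWindows x (goodWindow_frequently hS0 x hx))

/-- **BRIDGE 14293 ∧ 14294 ⇒ 3240** (proved; E0a, E0b1–3 landed): `LjLaminarity → LaminarSaturation → PeriodicWindows`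
— `LaminarRigidity` (14295) and `StackingFaultSparsity` (14296) are not needed. -/
theorem PeriodicWindows_of_laminarity_saturation (h14293 : LjLaminarity) (h14294 : LaminarSaturation) :
    PeriodicWindows :=
  PeriodicWindows_of_goodWindowsAE (h14294 h14293)

/-! ## Appended by lead c5 (rev 11): the weakest sufficient input on this line — ONE GOOD window per scale, frequently -/

/-- **BRIDGE (proved): one GOOD window per scale ⇒ the crux.** If every sequence of Lennard-Jones ground states has,
for every `R ≥ 2` and `ε > 0`, frequently in `N`, ONE particle `i` with a GOOD `(R, ε)`-window (ε-flat levels with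
gaps `≥ 19/25` along a unit normal, `19/20`-separation on the window, exactly `6 + 3 + 3` neighbours within distance
`1` of every particle of the half-window with `ε`-sharp lengths `a, b ∈ [19/20, 1]`), then `PeriodicWindows` holds:
`barlowWindows_of_goodWindows` (compactness E0a + exact rigidity E0b1–3) feeds the landed
`periodicWindows_of_barlowWindows`. [folklore] -/
theorem PeriodicWindows_of_oneGoodWindow
    (hG1 : ∀ x : (N : ℕ) → (Fin N → EuclideanSpace ℝ (Fin 3)), (∀ N, IsGroundState lennardJones (x N)) →
      ∀ R ε : ℝ, 2 ≤ R → 0 < ε → ∃ᶠ N in Filter.atTop, ∃ (i : Fin N) (a b : ℝ), 19 / 20 ≤ a ∧ a ≤ 1 ∧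
        19 / 20 ≤ b ∧ b ≤ 1 ∧ ∃ n : EuclideanSpace ℝ (Fin 3), ‖n‖ = 1 ∧ ∃ c : ℤ → ℝ,
        (∀ k : ℤ, c k + 19 / 25 ≤ c (k + 1)) ∧ ∃ l : Fin N → ℤ,
        (∀ j : Fin N, dist (x N j) (x N i) ≤ R → |inner ℝ (x N j - x N i) n - c (l j)| ≤ ε) ∧
        (∀ j k : Fin N, dist (x N j) (x N i) ≤ R → dist (x N k) (x N i) ≤ R → j ≠ k → 19 / 20 ≤ dist (x N j) (x N k)) ∧
        ∀ j : Fin N, dist (x N j) (x N i) ≤ R / 2 →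
          Nat.card {k : Fin N // k ≠ j ∧ l k = l j ∧ dist (x N j) (x N k) ≤ 1} = 6 ∧
          Nat.card {k : Fin N // l k = l j + 1 ∧ dist (x N j) (x N k) ≤ 1} = 3 ∧
          Nat.card {k : Fin N // l k = l j - 1 ∧ dist (x N j) (x N k) ≤ 1} = 3 ∧
          ∀ k : Fin N, k ≠ j → dist (x N j) (x N k) ≤ 1 →
            (l k = l j → |dist (x N j) (x N k) - a| ≤ ε) ∧ (l k ≠ l j → |dist (x N j) (x N k) - b| ≤ ε)) :
    PeriodicWindows := fun x hx =>
  periodicWindows_of_barlowWindows x hx (barlowWindows_of_goodWindows x (hG1 x hx))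

end Summit.AtomisticToContinuum.Crystallization.Theorems.PeriodicWindowsSketch

end
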